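import Summits.Ventures.YMGap.Conjectures.StrongCouplingSUNSchwingerDysonBetaOneLink
import HarnessLib
import HarnessLib.Audit.Tags

/-!
# The Schwinger–Dyson side for `SU(N)` at `β ≥ 0` (3/4): the bond bound with the baryon link density, `S_β(1) > 0`,
# and the site inequality

Cell `pub-ymgap`, seat qcd-lit g27 (literature-prover), `bears_on: Q1`.  Everything is a theorem (0 facts,
0 sorry).  Sequel of `…SUNSchwingerDysonBetaOneLink`:

* **`norm_remainder_SU_le`** — the plaquette-oscillation remainder of one bond term:
  `|∫∫ (e^{-βS_W(V[e←g])} - e^{-βS_W(V[e←1])}) ∫dψ̄dψ F kin_{x,e} e^{A}| ≤ κ(β)(S_β(F(σσ)_e) + S_β(F))`, `κ = kap N ν`,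
  `κ(0) = 0` (`norm_berezin_kinAt_le_SU` and `abs_plaqSU_update_sub_le`);
* **`re_suKinJ_le_SU`** — THE ONE-LINK BOUND WITH THE BARYON LINK DENSITY KEPT EXACT:
  `Re(s I_e(F)) ≤ N² e^{βc} S_β(F(σσ)_e) + N · Q_e^β(F) + κ(β)(S_β(F(σσ)_e) + S_β(F))`;
* `suSB_one_pos` — `S_β(1) > 0` at every real `β` (`N` odd `≥ 3`, from the tree's `Z_{β=0} ≠ 0` and `e^{-βS_W} > 0`);
  `suTwoPointB_eq_suSB_div` — `T_β(x,y) = (2N)² S_β((σσ)_{xy})/S_β(1)`;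
* **`sd_base_SU`** — THE SITE INEQUALITY AT `β ≥ 0` FOR `SU(N)`, UNIFORMLY IN THE VOLUME: for `x` even,
  `(N - 2νκ(β)) S_β(1) - N ∑_{e∋x} Q_e^β(1) ≤ (N² e^{βc} + κ(β)) ∑_{e∋x} S_β((σσ)_e)`
  (the Schwinger–Dyson equation `N S_β(1) = ∑_{e∋x} Re(s I_e(1))`, `suSB_schwingerDyson`, and the bond bound);
* `baryonDensitySU β x = ∑_{e∋x} Q_e^β(1) / S_β(1)` — **the baryon density at `x`** (at `β = 0`: the signed
  weight of the baryon loops of length `≥ 4` through `x` of the monomer–dimer–polymer representation, over `Z`).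

Honest framing: finite even torus, one staggered flavour, every `β ≥ 0` and every even `L`; a finite-volume
inequality with explicit volume-independent constants; NO bound on the baryon density is claimed — that is the
missing input isolated by this chain (see `…SUNSchwingerDysonBeta`).  Nothing about the thermodynamic/continuum
limit or the summit's QCD conjunct.

## References
* [SalmhoferSeiler1991] M. Salmhofer, E. Seiler, Commun. Math. Phys. 139 (1991) 395–432, §2 (2.9)–(2.12), (2.14),
  (3.44)–(3.46), (3.61)–(3.62), (4.31)–(4.34), Thm. 4.8 (4.38), §5 p. 424.
* [SeilerLNP1982] E. Seiler, LNP 159 (1982), Ch. 2.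
* [MontvayMunster1994] I. Montvay, G. Münster, *Quantum Fields on a Lattice* (1994) §5.1.6 (5.120)–(5.121).
* [FrommForcrand2008] M. Fromm, Ph. de Forcrand, arXiv:0811.1931, (4)–(7).
* [RossiWolff1984] P. Rossi, U. Wolff, Nucl. Phys. B248 (1984) 105–129, (13)–(23).
-/

noncomputable section

open MeasureTheory Finset
open scoped ComplexConjugate Matrix BigOperators
open Literature.MathematicalPhysics.QuantumFieldTheory (Site Edge GaugeConfig wilsonAction haarProbability)
open Literature.MathematicalPhysics.QuantumLattice
open Literature.MathematicalPhysics.QuantumLattice.GrassmannAlgebra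
open Literature.MathematicalPhysics.QuantumLattice.StrongCoupling
open Literature.MathematicalPhysics.QuantumLattice.StaggeredDeterminant (eoParity)
open Literature.MathematicalPhysics.StatisticalMechanics (ComplexSpin.uNBondCoeff)
open Literature.Probability.LatticeModels (TorusSite)

namespace Summit.Ventures.YMGap.Conjectures

namespace SchwingerDysonSU

open SchwingerDyson MesonWeightSU

variable {N ν L : ℕ} [NeZero ν] [NeZero L] [LinearOrder (TorusSite ν L)]

/-! ### The remainder: the oscillation of the plaquette weight against the kinetic insertion -/

/-- **Remainder bound**: `|∫∫ (e^{-βS_W(V[e←g])} - e^{-βS_W(V[e←1])}) ∫dψ̄dψ F kin_{x,e} e^{A}| ≤ κ(β)(S_β(F(σσ)_e) + S_β(F))`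
(`x` even, `e ∋ x`, `F` in the cone, `β ≥ 0`; `κ = kap N ν`, `κ(0) = 0`). [cite: SeilerLNP1982, Ch. 2] [cite: SalmhoferSeiler1991, (3.61)–(3.62), (4.31)–(4.34)] -/
theorem norm_remainder_SU_le (hL : Even L) (hN : N ≠ 0) {β : ℝ} (hβ : 0 ≤ β) {x : TorusSite ν L} (hx : x ∈ evens ν L)
    {e : Edge ν L} (hxe : (torusLinks ν L e).1 = x ∨ (torusLinks ν L e).2 = x) {F : FermiAlg (TorusSite ν L) N}
    (hF : IsChiralPositive (evens ν L) F) :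
    ‖∫ p, ((plaqSU N ν L β (Function.update p.1 e p.2) : ℂ) - plaqSU N ν L β (Function.update p.1 e 1)) *
        berezin ℂ _ (F * kinAt x (torusLinks ν L) (apSigns ν L) (fun b => OneLink.inclSU N (Function.update p.1 e p.2 b)) e *
          fWSU (Function.update p.1 e p.2)) ∂((gaugeMeasureSU N (Edge ν L)).prod (haarProbability (OneLink.SUN N)))‖ ≤
      kap N ν β * (suSB N ν L β (F * spinPair (torusLinks ν L e).1 (torusLinks ν L e).2) + suSB N ν L β F) := by
  set T : FermiAlg (TorusSite ν L) N := spinPair (torusLinks ν L e).1 (torusLinks ν L e).2 with hT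
  have hFT : IsChiralPositive (evens ν L) (F * T) := by
    have h := hF.mul (isChiralPositive_spinPair_pow' (N := N) (evens ν L) (torusLinks ν L e).1 (torusLinks ν L e).2 1)
    rwa [pow_one] at h
  have hr1c : Continuous fun p : GaugeConfig ν L (OneLink.SUN N) × OneLink.SUN N =>
      (chiralSign (N := N) (evens ν L) * berezin ℂ _ (F * T * fWSU (Function.update p.1 e p.2))).re :=
    Complex.continuous_re.comp (continuous_const.mul (continuous_berezin_upd_SU hL e _))
  have hr0c : Continuous fun p : GaugeConfig ν L (OneLink.SUN N) × OneLink.SUN N =>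
      (chiralSign (N := N) (evens ν L) * berezin ℂ _ (F * fWSU (Function.update p.1 e p.2))).re :=
    Complex.continuous_re.comp (continuous_const.mul (continuous_berezin_upd_SU hL e _))
  have hg1 : Integrable (fun p : GaugeConfig ν L (OneLink.SUN N) × OneLink.SUN N => plaqSU N ν L β (Function.update p.1 e p.2) *
      (chiralSign (N := N) (evens ν L) * berezin ℂ _ (F * T * fWSU (Function.update p.1 e p.2))).re)
      ((gaugeMeasureSU N (Edge ν L)).prod (haarProbability (OneLink.SUN N))) :=
    integrable_of_continuous_prod_SU ((continuous_plaqSU_upd (N := N) β e).mul hr1c)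
  have hg0 : Integrable (fun p : GaugeConfig ν L (OneLink.SUN N) × OneLink.SUN N => plaqSU N ν L β (Function.update p.1 e p.2) *
      (chiralSign (N := N) (evens ν L) * berezin ℂ _ (F * fWSU (Function.update p.1 e p.2))).re)
      ((gaugeMeasureSU N (Edge ν L)).prod (haarProbability (OneLink.SUN N))) :=
    integrable_of_continuous_prod_SU ((continuous_plaqSU_upd (N := N) β e).mul hr0c)
  have hbound : ∀ p : GaugeConfig ν L (OneLink.SUN N) × OneLink.SUN N,
      ‖((plaqSU N ν L β (Function.update p.1 e p.2) : ℂ) - plaqSU N ν L β (Function.update p.1 e 1)) *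
        berezin ℂ _ (F * kinAt x (torusLinks ν L) (apSigns ν L) (fun b => OneLink.inclSU N (Function.update p.1 e p.2 b)) e *
          fWSU (Function.update p.1 e p.2))‖ ≤
      kap N ν β * (plaqSU N ν L β (Function.update p.1 e p.2) *
          (chiralSign (N := N) (evens ν L) * berezin ℂ _ (F * T * fWSU (Function.update p.1 e p.2))).re +
        plaqSU N ν L β (Function.update p.1 e p.2) *
          (chiralSign (N := N) (evens ν L) * berezin ℂ _ (F * fWSU (Function.update p.1 e p.2))).re) := by
    intro p
    have hosc := abs_plaqSU_update_sub_le (N := N) hβ p.1 e p.2 1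
    have hup := plaqSU_update_le (N := N) hβ p.1 e 1 p.2
    have hkin := norm_berezin_kinAt_le_SU hL hN hx hxe hF (Function.update p.1 e p.2)
    rw [← hT] at hkin
    have hr1 := (chiralSign_mul_berezin_fWSU hL hFT (Function.update p.1 e p.2)).1
    have hr0 := (chiralSign_mul_berezin_fWSU hL hF (Function.update p.1 e p.2)).1
    have hδ : 0 ≤ Real.exp (β * linkOsc ν N) - 1 := by
      linarith [Real.one_le_exp (mul_nonneg hβ (linkOsc_nonneg ν N))]
    rw [norm_mul, ← Complex.ofReal_sub, Complex.norm_real, Real.norm_eq_abs]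
    calc |plaqSU N ν L β (Function.update p.1 e p.2) - plaqSU N ν L β (Function.update p.1 e 1)| *
          ‖berezin ℂ _ (F * kinAt x (torusLinks ν L) (apSigns ν L) (fun b => OneLink.inclSU N (Function.update p.1 e p.2 b)) e *
            fWSU (Function.update p.1 e p.2))‖
        ≤ ((Real.exp (β * linkOsc ν N) - 1) * plaqSU N ν L β (Function.update p.1 e 1)) *
            (((N : ℝ) * Real.sqrt N / 2) * ((chiralSign (N := N) (evens ν L) *
                berezin ℂ _ (F * T * fWSU (Function.update p.1 e p.2))).re +
              (chiralSign (N := N) (evens ν L) * berezin ℂ _ (F * fWSU (Function.update p.1 e p.2))).re)) :=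
          mul_le_mul hosc hkin (norm_nonneg _) (mul_nonneg hδ (plaqSU_pos β _).le)
      _ ≤ ((Real.exp (β * linkOsc ν N) - 1) * (Real.exp (β * linkOsc ν N) * plaqSU N ν L β (Function.update p.1 e p.2))) *
            (((N : ℝ) * Real.sqrt N / 2) * ((chiralSign (N := N) (evens ν L) *
                berezin ℂ _ (F * T * fWSU (Function.update p.1 e p.2))).re +
              (chiralSign (N := N) (evens ν L) * berezin ℂ _ (F * fWSU (Function.update p.1 e p.2))).re)) :=
          mul_le_mul_of_nonneg_right (mul_le_mul_of_nonneg_left hup hδ) (mul_nonneg (by positivity) (add_nonneg hr1 hr0))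
      _ = _ := by rw [kap]; ring
  have hg : Integrable (fun p : GaugeConfig ν L (OneLink.SUN N) × OneLink.SUN N =>
      kap N ν β * (plaqSU N ν L β (Function.update p.1 e p.2) *
          (chiralSign (N := N) (evens ν L) * berezin ℂ _ (F * T * fWSU (Function.update p.1 e p.2))).re +
        plaqSU N ν L β (Function.update p.1 e p.2) *
          (chiralSign (N := N) (evens ν L) * berezin ℂ _ (F * fWSU (Function.update p.1 e p.2))).re))
      ((gaugeMeasureSU N (Edge ν L)).prod (haarProbability (OneLink.SUN N))) := (hg1.add hg0).const_mul _
  refine (norm_integral_le_of_norm_le hg (ae_of_all _ hbound)).trans (le_of_eq ?_)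
  rw [integral_const_mul, integral_add hg1 hg0, ← suSB_eq_integral_prod hL β e, ← suSB_eq_integral_prod hL β e]

/-! ### One bond term of the Schwinger–Dyson equation at `β ≥ 0` for `SU(N)` -/

/-- **THE ONE-LINK BOUND FOR `SU(N)` AT `β ≥ 0` WITH THE BARYON LINK DENSITY KEPT EXACT.**  For `x` even, a bond
`e ∋ x`, `F` in the chiral cone, `β ≥ 0`, every `N ≥ 1` and every even `L`:
`Re(s I_e(F)) ≤ N² e^{βc} S_β(F(σσ)_e) + N · Q_e^β(F) + κ(β) (S_β(F(σσ)_e) + S_β(F))`,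
`c = linkOsc ν N`, `κ = kap N ν`.  For `U(N)` (`Q ≡ 0`) this is the tree's `re_bondIntegral_le_sharp`. [cite: SalmhoferSeiler1991, (3.44)–(3.46), (4.31)–(4.34), §5 p. 424] [cite: SeilerLNP1982, Ch. 2] -/
theorem re_suKinJ_le_SU (hL : Even L) (hN : 0 < N) {β : ℝ} (hβ : 0 ≤ β) {x : TorusSite ν L} (hx : x ∈ evens ν L)
    {e : Edge ν L} (hxe : (torusLinks ν L e).1 = x ∨ (torusLinks ν L e).2 = x) {F : FermiAlg (TorusSite ν L) N}
    (hF : IsChiralPositive (evens ν L) F) :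
    (chiralSign (N := N) (evens ν L) * suKinJ N ν L β x e F).re ≤
      (N : ℝ) ^ 2 * Real.exp (β * linkOsc ν N) * suSB N ν L β (F * spinPair (torusLinks ν L e).1 (torusLinks ν L e).2) +
        (N : ℝ) * baryonLinkSU N ν L β x e F +
        kap N ν β * (suSB N ν L β (F * spinPair (torusLinks ν L e).1 (torusLinks ν L e).2) + suSB N ν L β F) := by
  have hA1 : Integrable (fun p : GaugeConfig ν L (OneLink.SUN N) × OneLink.SUN N =>
      (plaqSU N ν L β (Function.update p.1 e 1) : ℂ) *
        berezin ℂ _ (F * kinAt x (torusLinks ν L) (apSigns ν L) (fun b => OneLink.inclSU N (Function.update p.1 e p.2 b)) e *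
          fWSU (Function.update p.1 e p.2))) ((gaugeMeasureSU N (Edge ν L)).prod (haarProbability (OneLink.SUN N))) :=
    integrable_of_continuous_prod_SU ((Complex.continuous_ofReal.comp (continuous_plaqSU_upd_one β e)).mul
      (continuous_berezin_kin_upd_SU hL x e F))
  have hA : Integrable (fun p : GaugeConfig ν L (OneLink.SUN N) × OneLink.SUN N =>
      (plaqSU N ν L β (Function.update p.1 e p.2) : ℂ) *
        berezin ℂ _ (F * kinAt x (torusLinks ν L) (apSigns ν L) (fun b => OneLink.inclSU N (Function.update p.1 e p.2 b)) e *
          fWSU (Function.update p.1 e p.2))) ((gaugeMeasureSU N (Edge ν L)).prod (haarProbability (OneLink.SUN N))) :=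
    integrable_of_continuous_prod_SU ((Complex.continuous_ofReal.comp (continuous_plaqSU_upd β e)).mul
      (continuous_berezin_kin_upd_SU hL x e F))
  have hsplit : suKinJ N ν L β x e F =
      (∫ p, (plaqSU N ν L β (Function.update p.1 e 1) : ℂ) *
          berezin ℂ _ (F * kinAt x (torusLinks ν L) (apSigns ν L) (fun b => OneLink.inclSU N (Function.update p.1 e p.2 b)) e *
            fWSU (Function.update p.1 e p.2)) ∂((gaugeMeasureSU N (Edge ν L)).prod (haarProbability (OneLink.SUN N)))) +
        ∫ p, ((plaqSU N ν L β (Function.update p.1 e p.2) : ℂ) - plaqSU N ν L β (Function.update p.1 e 1)) *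
          berezin ℂ _ (F * kinAt x (torusLinks ν L) (apSigns ν L) (fun b => OneLink.inclSU N (Function.update p.1 e p.2 b)) e *
            fWSU (Function.update p.1 e p.2)) ∂((gaugeMeasureSU N (Edge ν L)).prod (haarProbability (OneLink.SUN N))) := by
    rw [suKinJ_eq_integral_prod hL β x e F, ← integral_add hA1 ((hA.sub hA1).congr (ae_of_all _ fun p => by
      simp only [Pi.sub_apply]; ring))]
    exact integral_congr_ae (ae_of_all _ fun p => by ring)
  rw [hsplit, mul_add (chiralSign (N := N) (evens ν L)), Complex.add_re, re_mainTerm_SU_eq hL hN β hxe F]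
  have hmes := re_mesonMain_SU_le hL hN hβ e hF
  have hrem := norm_remainder_SU_le hL hN.ne' hβ hx hxe hF
  have hre2 := (Complex.abs_re_le_norm (chiralSign (N := N) (evens ν L) *
    ∫ p, ((plaqSU N ν L β (Function.update p.1 e p.2) : ℂ) - plaqSU N ν L β (Function.update p.1 e 1)) *
      berezin ℂ _ (F * kinAt x (torusLinks ν L) (apSigns ν L) (fun b => OneLink.inclSU N (Function.update p.1 e p.2 b)) e *
        fWSU (Function.update p.1 e p.2)) ∂((gaugeMeasureSU N (Edge ν L)).prod (haarProbability (OneLink.SUN N))))).trans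
    (by rw [norm_mul, norm_chiralSign, one_mul])
  have hre' := (abs_le.mp (hre2.trans hrem)).2
  linarith

/-! ### `S_β(1) > 0` and the kernel in terms of `S_β` -/

/-- **`S_β(1) > 0` at every real `β`** (`N` odd, `N ≥ 3`, even torus): `S_0(1) = s·Z ≠ 0` is the tree's
`suJ_one_ne_zero`, and `S_β(1) = ∫ e^{-βS_W} f` with the same continuous `f ≥ 0` and `e^{-βS_W} > 0`, so
`S_β(1) = 0` would force `f = 0` a.e. and `S_0(1) = 0`. [cite: FrommForcrand2008, (6)–(7)] [cite: SalmhoferSeiler1991, §2 (2.9)–(2.12)] -/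
theorem suSB_one_pos (hN : Odd N) (h1 : 1 < N) (hL : Even L) (β : ℝ) : 0 < suSB N ν L β 1 := by
  have hs : chiralSign (N := N) (evens ν L) ≠ 0 := fun h0 => by
    have := chiralSign_mul_self (N := N) (evens ν L); rw [h0, zero_mul] at this; exact zero_ne_one this
  have h0 : suSB N ν L 0 1 ≠ 0 := by
    intro h
    have h2 := chiralSign_mul_suJB hL 0 (IsChiralPositive.one (N := N) (E := evens ν L))
    rw [h, Complex.ofReal_zero, mul_eq_zero, suJB_zero hL] at h2
    exact h2.elim hs (suJ_one_ne_zero hN h1 hL)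
  by_contra hle
  have hz : suSB N ν L β 1 = 0 := le_antisymm (not_lt.mp hle) (suSB_nonneg hL β IsChiralPositive.one)
  have hf0 : ∀ V : GaugeConfig ν L (OneLink.SUN N), 0 ≤ (chiralSign (N := N) (evens ν L) *
      berezin ℂ _ (1 * fermiBoltzmannSU (torusLinks ν L) (apSigns ν L) 0 V)).re :=
    fun V => (chiralSign_mul_berezin_fBSU hL IsChiralPositive.one V).1
  have hcont : Continuous fun V : GaugeConfig ν L (OneLink.SUN N) => (chiralSign (N := N) (evens ν L) *
      berezin ℂ _ (1 * fermiBoltzmannSU (torusLinks ν L) (apSigns ν L) 0 V)).re :=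
    Complex.continuous_re.comp (continuous_const.mul (continuous_apply_of_coeffContinuous ((CoeffContinuous.const _).mul
      (coeffContinuous_fermiBoltzmannSU _ (torusLinks_ne (StaggeredRP.one_lt_of_even_neZero hL)) _ _)) _))
  have hint : Integrable (fun V : GaugeConfig ν L (OneLink.SUN N) => plaqSU N ν L β V * (chiralSign (N := N) (evens ν L) *
      berezin ℂ _ (1 * fermiBoltzmannSU (torusLinks ν L) (apSigns ν L) 0 V)).re) (gaugeMeasureSU N (TorusSite ν L × Fin ν)) :=
    integrable_of_continuous_SU ((continuous_plaqSU β).mul hcont)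
  have hae := (integral_eq_zero_iff_of_nonneg (fun V => mul_nonneg (plaqSU_pos β V).le (hf0 V)) hint).mp hz
  have hae0 : (fun V : GaugeConfig ν L (OneLink.SUN N) => plaqSU N ν L 0 V * (chiralSign (N := N) (evens ν L) *
      berezin ℂ _ (1 * fermiBoltzmannSU (torusLinks ν L) (apSigns ν L) 0 V)).re) =ᵐ[gaugeMeasureSU N (TorusSite ν L × Fin ν)] 0 := by
    filter_upwards [hae] with V hV
    have h := (mul_eq_zero.mp hV).resolve_left (plaqSU_pos β V).ne'
    simp only [Pi.zero_apply, h, mul_zero]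
  refine h0 ?_
  rw [suSB, integral_congr_ae hae0]
  simp

/-- **The kernel through `S_β`**: `T_β(x,y) = (2N)² S_β((σσ)_{xy}) / S_β(1)` (`ψ̄ψ(x)ψ̄ψ(y) = (2N)²(σσ)_{xy}`,
`s J_β = S_β` on the cone). [cite: SalmhoferSeiler1991, §2 (2.14), (3.100)] -/
theorem suTwoPointB_eq_suSB_div (hN : N ≠ 0) (hL : Even L) (β : ℝ) (x y : TorusSite ν L) :
    suTwoPointB N ν L β x y = (2 * N : ℝ) ^ 2 * suSB N ν L β (spinPair x y) / suSB N ν L β 1 := by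
  have hs : chiralSign (N := N) (evens ν L) ≠ 0 := fun h0 => by
    have := chiralSign_mul_self (N := N) (evens ν L); rw [h0, zero_mul] at this; exact zero_ne_one this
  have hT : IsChiralPositive (evens ν L) (spinPair x y : FermiAlg (TorusSite ν L) N) := by
    have h := isChiralPositive_spinPair_pow' (N := N) (evens ν L) x y 1
    rwa [pow_one] at h
  rw [suTwoPointB, meson_mul_meson_eq_smul_spinPair hN, suJB_smul, ← mul_div_mul_left _ _ hs, mul_left_comm,
    chiralSign_mul_suJB hL β hT, chiralSign_mul_suJB hL β IsChiralPositive.one, ← Complex.ofReal_mul,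
    ← Complex.ofReal_div, Complex.ofReal_re]

/-! ### The site inequality at `β ≥ 0` for `SU(N)` and the baryon density -/

/-- **THE SITE INEQUALITY AT `β ≥ 0` FOR `SU(N)`, UNIFORMLY IN THE VOLUME**: for every `N ≥ 1`, `x` even,
`β ≥ 0` and every even `L`,
`(N - 2νκ(β)) S_β(1) - N ∑_{e ∋ x} Q_e^β(1) ≤ (N² e^{βc} + κ(β)) ∑_{e ∋ x} S_β((σσ)_e)`.
For `U(N)` (`Q ≡ 0`) this is the tree's `sd_base_sharp`; at `β = 0` it reads `Z (1 - P_B(x)) ≤ N ∑_{e∋x} S((σσ)_e)`. [cite: SalmhoferSeiler1991, Thm. 4.8 (4.38), §5 p. 424] -/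
theorem sd_base_SU (hL : Even L) (hN : 0 < N) {β : ℝ} (hβ : 0 ≤ β) {x : TorusSite ν L} (hx : x ∈ evens ν L) :
    ((N : ℝ) - 2 * ν * kap N ν β) * suSB N ν L β 1 - (N : ℝ) * ∑ e ∈ bondsAt ν L x, baryonLinkSU N ν L β x e 1 ≤
      ((N : ℝ) ^ 2 * Real.exp (β * linkOsc ν N) + kap N ν β) *
        ∑ e ∈ bondsAt ν L x, suSB N ν L β (spinPair (torusLinks ν L e).1 (torusLinks ν L e).2) := by
  have hSD := suSB_schwingerDyson (N := N) hL β x (F := 1) (n := 0) (by rw [chargeOp_one, Complex.ofReal_zero, zero_smul])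
  have hκ0 : 0 ≤ kap N ν β := kap_nonneg hβ
  have hS1 : 0 ≤ suSB N ν L β 1 := suSB_nonneg hL β IsChiralPositive.one
  have hbond : ∀ e ∈ bondsAt ν L x, (chiralSign (N := N) (evens ν L) * suKinJ N ν L β x e 1).re ≤
      ((N : ℝ) ^ 2 * Real.exp (β * linkOsc ν N) + kap N ν β) * suSB N ν L β (spinPair (torusLinks ν L e).1 (torusLinks ν L e).2) +
        (N : ℝ) * baryonLinkSU N ν L β x e 1 + kap N ν β * suSB N ν L β 1 := by
    intro e he
    have h := re_suKinJ_le_SU hL hN hβ hx (mem_bondsAt.mp he) IsChiralPositive.one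
    simp only [one_mul] at h
    nlinarith [h]
  have hsum := Finset.sum_le_sum hbond
  rw [← hSD, Finset.sum_add_distrib, Finset.sum_add_distrib, Finset.sum_const, nsmul_eq_mul, ← Finset.mul_sum,
    ← Finset.mul_sum] at hsum
  have hcard : ((bondsAt ν L x).card : ℝ) ≤ 2 * ν := by
    have h3 := card_bondsAt_le (ν := ν) (L := L) x
    have h4 : (((bondsAt ν L x).card : ℕ) : ℝ) ≤ (ν : ℝ) + ν := by exact_mod_cast h3
    linarith
  have h1 : ((bondsAt ν L x).card : ℝ) * (kap N ν β * suSB N ν L β 1) ≤ 2 * ν * (kap N ν β * suSB N ν L β 1) :=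
    mul_le_mul_of_nonneg_right hcard (mul_nonneg hκ0 hS1)
  rw [sub_zero] at hsum
  linarith

variable (N ν L) in
/-- **The baryon density at `x`, coupling `β`**: `P_B^β(x) = ∑_{e ∋ x} Q_e^β(1) / S_β(1)` — `≡ 0` for `U(N)`; at
`β = 0` the signed weight, over `Z`, of the baryon loops of length `≥ 4` through `x` of the monomer–dimer–polymer
representation. [cite: RossiWolff1984, (21)–(23)] [cite: FrommForcrand2008, (4)–(7)] [cite: SalmhoferSeiler1991, §5 p. 424] -/
def baryonDensitySU (β : ℝ) (x : TorusSite ν L) : ℝ :=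
  (∑ e ∈ bondsAt ν L x, baryonLinkSU N ν L β x e 1) / suSB N ν L β 1

end SchwingerDysonSU

end Summit.Ventures.YMGap.Conjectures

end
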